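import Mathlib
import Literature.Computability.AlgebraicComplexity.NewtonPolygonTauProductBounds
import Summits.ValiantsHypothesis.ValiantsHypothesis.Theorems.NewtonUnitEquationsDissociatedUniformTotalsLaw
import Summits.ValiantsHypothesis.ValiantsHypothesis.Theorems.NewtonUnitEquationsDissociatedUniformTotalsLawChartTops
import HarnessLib

/-!
# Crux `NewtonUnitEquations.DissociatedUniform` (stmt-ValiantsHypothesis-5905): the `n = 3` totals law — HEIGHT MONOTONICITY
# (chart tops climb strictly in one coordinate; the law on the bounded-resolution / arithmetic-progression stratum, pointwise)

Memo `Cruxes/DissociatedUniform/NOTES-t1g17.md` §1.  Along a half-chart of weights `(σ, t)`, `t ∈ ℝ` increasing, the strict top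
of ANY finite planar set `F` moves to strictly LARGER second coordinate ("height") at every change of top
(`snd_lt_snd_of_isStrictTop`: the advantage of the old top over the new one is affine in `t` with slope the height difference,
positive before and negative after).  Hence the chart tops of `F` inject into the set of heights of `F`
(`card_chartTops_le_card_image_snd`) and, both half-charts together,
**`#vert conv F ≤ 2 · #{heights of F}`** (`ncard_extremePoints_le_two_mul_card_image_snd`).

For model (Q**) (`…TotalsLaw`: classes `{a x + b y + c z : x + y + z = s}`, `V_s = classVert`, `T = totalVert`) the heights of a class
lie in the TRIPLE SUMSET `A₁ + B₁ + C₁` of the three height sets `A₁ = {a x 1}`, `B₁ = {b y 1}`, `C₁ = {c z 1}`, so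
* `classVert_le_two_mul_card_heightSumset` : **`V_s ≤ 2 · #(A₁ + B₁ + C₁)`** — POINTWISE, every class (pointwise class bounds are
  false in general, `…TotalsLawParabolaGadget`; additive structure of the heights restores one);
* `totalVert_le_two_mul_card_mul_card_heightSumset` : **`T ≤ 2 · |G| · #(A₁ + B₁ + C₁)`**;
* the ARITHMETIC-PROGRESSION / INTEGER-GRID stratum: if the heights of the three curves lie in arithmetic progressions
  `u_a + kδ`, `u_b + kδ`, `u_c + kδ`, `k ≤ N` (common step; e.g. curves drawn on an integer grid with `N + 1` rows), then
  `#(A₁ + B₁ + C₁) ≤ 3N + 1`, so `V_s ≤ 2(3N + 1)` (`classVert_le_of_apHeights`) and **`T ≤ 2|G|(3N + 1)`**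
  (`totalVert_le_of_apHeights`); with `N ≤ K|G|`: `T ≤ (6K + 2)|G|²` (`totalVert_le_sq_of_apHeights`) — the totals law
  `TotalsLawThree`-shaped with constant `6K + 2` on the stratum of curves of height-resolution `≤ K|G|` (in any ONE direction,
  after a rotation of the plane).
So every census family drawn on an integer grid of `O(q)` rows obeys the law for free, and a violation of `TotalsLawThree C` needs
heights without additive structure at resolution `|G|` in every direction (the parabola gadget's one class of `q²/4` vertices uses
heights of size `≍ q⁴`).  Honest label: an elementary stratum theorem (the Newton-polygon-of-bounded-degree remark transported to
(Q**)); `TotalsLawThree C` remains OPEN and is asserted nowhere; nothing here bears on VP ≠ VNP.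
[folklore: along a rotating support direction the exposed vertex of a convex polygon advances monotonically]
-/

set_option linter.dupNamespace false -- `ValiantsHypothesis.ValiantsHypothesis` (summit = problem) in every name

open Matrix Finset
open scoped BigOperators Pointwise

namespace Summit.ValiantsHypothesis.ValiantsHypothesis.Theorems.NewtonUnitEquationsDissociatedUniform

namespace TotalsLaw

open Literature.Computability.AlgebraicComplexity.KPTT.PlanarMinkowski

/-! ### Chart tops climb in height -/

/-- **Height monotonicity of the sweep.**  If `x` is the strict `(σ, t)`-top of `F` and `x' ≠ x` the strict `(σ, t')`-top at a
later time `t' > t`, then `x 1 < x' 1`: adding the two strict inequalities `⟨(σ,t), x'⟩ < ⟨(σ,t), x⟩` and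
`⟨(σ,t'), x⟩ < ⟨(σ,t'), x'⟩` gives `(t' − t)(x' 1 − x 1) > 0`. [folklore] -/
theorem snd_lt_snd_of_isStrictTop {σ t t' : ℝ} {F : Finset (Fin 2 → ℝ)} {x x' : Fin 2 → ℝ}
    (hx : IsStrictTop ![σ, t] F x) (hx' : IsStrictTop ![σ, t'] F x') (hne : x ≠ x') (htt' : t < t') : x 1 < x' 1 := by
  have e1 : ![σ, t] ⬝ᵥ x' < ![σ, t] ⬝ᵥ x := hx.lt hx'.mem (Ne.symm hne)
  have e2 : ![σ, t'] ⬝ᵥ x < ![σ, t'] ⬝ᵥ x' := hx'.lt hx.mem hne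
  simp only [chart_dotProduct] at e1 e2
  nlinarith

/-- Distinct chart tops (same half-chart) have distinct heights. [folklore] -/
theorem snd_ne_snd_of_isStrictTop {σ t t' : ℝ} {F : Finset (Fin 2 → ℝ)} {x x' : Fin 2 → ℝ}
    (hx : IsStrictTop ![σ, t] F x) (hx' : IsStrictTop ![σ, t'] F x') (hne : x ≠ x') : x 1 ≠ x' 1 := by
  rcases lt_trichotomy t t' with h | rfl | h
  · exact (snd_lt_snd_of_isStrictTop hx hx' hne h).ne
  · exact absurd (hx.unique hx') hne
  · exact (snd_lt_snd_of_isStrictTop hx' hx (Ne.symm hne) h).ne'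

open Classical in
/-- **Chart tops inject into heights**: along one half-chart, `#tops_σ(F) ≤ #{x 1 : x ∈ F}`. [folklore] -/
theorem card_chartTops_le_card_image_snd (σ : ℝ) (F : Finset (Fin 2 → ℝ)) :
    (F.filter fun x => ∃ t, IsStrictTop ![σ, t] F x).card ≤ (F.image fun x => x 1).card := by
  classical
  refine Finset.card_le_card_of_injOn (fun x => x 1) (fun x hx => ?_) ?_
  · exact Finset.mem_coe.2 (Finset.mem_image_of_mem _ (Finset.mem_filter.1 (Finset.mem_coe.1 hx)).1)
  · intro x hx x' hx' h
    by_contra hne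
    obtain ⟨-, t, ht⟩ := Finset.mem_filter.1 (Finset.mem_coe.1 hx)
    obtain ⟨-, t', ht'⟩ := Finset.mem_filter.1 (Finset.mem_coe.1 hx')
    exact snd_ne_snd_of_isStrictTop ht ht' hne h

/-- **`#vert conv F ≤ 2 · #{heights of F}`** (both half-charts). [folklore] -/
theorem ncard_extremePoints_le_two_mul_card_image_snd (F : Finset (Fin 2 → ℝ)) :
    ((convexHull ℝ (F : Set (Fin 2 → ℝ))).extremePoints ℝ).ncard ≤ 2 * (F.image fun x => x 1).card := by
  classical
  rw [extremePoints_eq_coe_filter_charts F, Set.ncard_coe_finset, Finset.filter_or]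
  calc _ ≤ (F.filter fun x => ∃ t, IsStrictTop ![1, t] F x).card +
          (F.filter fun x => ∃ t, IsStrictTop ![-1, t] F x).card := Finset.card_union_le _ _
    _ ≤ (F.image fun x => x 1).card + (F.image fun x => x 1).card :=
        Nat.add_le_add (card_chartTops_le_card_image_snd 1 F) (card_chartTops_le_card_image_snd (-1) F)
    _ = 2 * (F.image fun x => x 1).card := by ring

/-! ### Classes of model (Q**): heights lie in the triple sumset of the height sets -/

variable {G : Type*} [AddCommGroup G] [Fintype G]

open Classical in
/-- **Pointwise: `V_s ≤ 2 · #{heights of class s}`.** [folklore] -/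
theorem classVert_le_two_mul_card_classHeights (a b c : G → (Fin 2 → ℝ)) (s : G) :
    classVert a b c s ≤ 2 * (Finset.univ.image fun p : G × G => a p.1 1 + b p.2 1 + c (s - p.1 - p.2) 1).card := by
  classical
  set F := Finset.univ.image fun p : G × G => a p.1 + b p.2 + c (s - p.1 - p.2) with hF
  have hcoe : (F : Set (Fin 2 → ℝ)) = classPts a b c s := by
    rw [hF, Finset.coe_image, Finset.coe_univ, Set.image_univ]; rfl
  have himg : (F.image fun x => x 1) = Finset.univ.image fun p : G × G => a p.1 1 + b p.2 1 + c (s - p.1 - p.2) 1 := by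
    rw [hF, Finset.image_image]
    rfl
  unfold classVert
  rw [← hcoe, ← himg]
  exact ncard_extremePoints_le_two_mul_card_image_snd F

open Classical in
/-- The heights of class `s` lie in the triple sumset `A₁ + B₁ + C₁` of the height sets of the three curves. [folklore] -/
theorem classHeights_subset_heightSumset (a b c : G → (Fin 2 → ℝ)) (s : G) :
    (Finset.univ.image fun p : G × G => a p.1 1 + b p.2 1 + c (s - p.1 - p.2) 1) ⊆
      Finset.univ.image (fun x => a x 1) + Finset.univ.image (fun y => b y 1) + Finset.univ.image (fun z => c z 1) := by
  intro h hh
  obtain ⟨p, -, rfl⟩ := Finset.mem_image.1 hh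
  exact Finset.add_mem_add (Finset.add_mem_add (Finset.mem_image_of_mem _ (Finset.mem_univ _))
    (Finset.mem_image_of_mem _ (Finset.mem_univ _))) (Finset.mem_image_of_mem _ (Finset.mem_univ _))

open Classical in
/-- **Pointwise: `V_s ≤ 2 · #(A₁ + B₁ + C₁)`** — the hull of every class has at most twice as many vertices as the triple sumset of
the three height sets has elements. [folklore] -/
theorem classVert_le_two_mul_card_heightSumset (a b c : G → (Fin 2 → ℝ)) (s : G) :
    classVert a b c s ≤ 2 * (Finset.univ.image (fun x => a x 1) + Finset.univ.image (fun y => b y 1) +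
      Finset.univ.image (fun z => c z 1)).card :=
  (classVert_le_two_mul_card_classHeights a b c s).trans
    (Nat.mul_le_mul_left 2 (Finset.card_le_card (classHeights_subset_heightSumset a b c s)))

open Classical in
/-- **Totals: `T ≤ 2 · |G| · #(A₁ + B₁ + C₁)`.** [folklore] -/
theorem totalVert_le_two_mul_card_mul_card_heightSumset (a b c : G → (Fin 2 → ℝ)) :
    totalVert a b c ≤ 2 * Fintype.card G * (Finset.univ.image (fun x => a x 1) + Finset.univ.image (fun y => b y 1) +
      Finset.univ.image (fun z => c z 1)).card := by
  unfold totalVert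
  calc ∑ s, classVert a b c s ≤ ∑ _s : G, 2 * (Finset.univ.image (fun x => a x 1) + Finset.univ.image (fun y => b y 1) +
          Finset.univ.image (fun z => c z 1)).card :=
        Finset.sum_le_sum fun s _ => classVert_le_two_mul_card_heightSumset a b c s
    _ = _ := by rw [Finset.sum_const, Finset.card_univ, smul_eq_mul]; ring

/-! ### The arithmetic-progression (integer-grid) stratum -/

/-- An arithmetic progression `{u + k δ : k ≤ N}` as a finite set of reals. -/
private theorem mem_image_ap {u δ h : ℝ} {N : ℕ} (hk : ∃ k : ℕ, k ≤ N ∧ h = u + k * δ) :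
    h ∈ (Finset.range (N + 1)).image fun k : ℕ => u + (k : ℝ) * δ := by
  obtain ⟨k, hk, rfl⟩ := hk
  exact Finset.mem_image.2 ⟨k, Finset.mem_range.2 (Nat.lt_succ_of_le hk), rfl⟩

omit [AddCommGroup G] in
open Classical in
/-- **Heights in arithmetic progressions of a common step.**  If `a x 1 = u_a + kδ`, `b y 1 = u_b + kδ`, `c z 1 = u_c + kδ` with
`k ≤ N` (depending on the letter), the triple height sumset lies in the progression `(u_a + u_b + u_c) + kδ`, `k ≤ 3N`:
`#(A₁ + B₁ + C₁) ≤ 3N + 1`. [folklore] -/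
theorem card_heightSumset_le_of_apHeights (a b c : G → (Fin 2 → ℝ)) (ua ub uc δ : ℝ) (N : ℕ)
    (ha : ∀ x, ∃ k : ℕ, k ≤ N ∧ a x 1 = ua + k * δ) (hb : ∀ y, ∃ k : ℕ, k ≤ N ∧ b y 1 = ub + k * δ)
    (hc : ∀ z, ∃ k : ℕ, k ≤ N ∧ c z 1 = uc + k * δ) :
    (Finset.univ.image (fun x => a x 1) + Finset.univ.image (fun y => b y 1) + Finset.univ.image (fun z => c z 1)).card ≤
      3 * N + 1 := by
  classical
  have hsub : Finset.univ.image (fun x => a x 1) + Finset.univ.image (fun y => b y 1) + Finset.univ.image (fun z => c z 1) ⊆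
      (Finset.range (3 * N + 1)).image fun k : ℕ => (ua + ub + uc) + (k : ℝ) * δ := by
    intro h hh
    obtain ⟨hab, hab_mem, hz, hz_mem, rfl⟩ := Finset.mem_add.1 hh
    obtain ⟨hx, hx_mem, hy, hy_mem, rfl⟩ := Finset.mem_add.1 hab_mem
    obtain ⟨x, -, rfl⟩ := Finset.mem_image.1 hx_mem
    obtain ⟨y, -, rfl⟩ := Finset.mem_image.1 hy_mem
    obtain ⟨z, -, rfl⟩ := Finset.mem_image.1 hz_mem
    obtain ⟨i, hi, hix⟩ := ha x
    obtain ⟨j, hj, hjy⟩ := hb y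
    obtain ⟨l, hl, hlz⟩ := hc z
    refine Finset.mem_image.2 ⟨i + j + l, Finset.mem_range.2 (by omega), ?_⟩
    rw [hix, hjy, hlz]
    push_cast
    ring
  refine (Finset.card_le_card hsub).trans (Finset.card_image_le.trans ?_)
  rw [Finset.card_range]

open Classical in
/-- **Pointwise class bound on the AP stratum: `V_s ≤ 2(3N + 1)`.** [folklore] -/
theorem classVert_le_of_apHeights (a b c : G → (Fin 2 → ℝ)) (ua ub uc δ : ℝ) (N : ℕ)
    (ha : ∀ x, ∃ k : ℕ, k ≤ N ∧ a x 1 = ua + k * δ) (hb : ∀ y, ∃ k : ℕ, k ≤ N ∧ b y 1 = ub + k * δ)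
    (hc : ∀ z, ∃ k : ℕ, k ≤ N ∧ c z 1 = uc + k * δ) (s : G) :
    classVert a b c s ≤ 2 * (3 * N + 1) :=
  (classVert_le_two_mul_card_heightSumset a b c s).trans
    (Nat.mul_le_mul_left 2 (card_heightSumset_le_of_apHeights a b c ua ub uc δ N ha hb hc))

open Classical in
/-- **Totals on the AP stratum: `T ≤ 2|G|(3N + 1)`** — e.g. curves drawn on an integer grid with `N + 1` rows. [folklore] -/
theorem totalVert_le_of_apHeights (a b c : G → (Fin 2 → ℝ)) (ua ub uc δ : ℝ) (N : ℕ)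
    (ha : ∀ x, ∃ k : ℕ, k ≤ N ∧ a x 1 = ua + k * δ) (hb : ∀ y, ∃ k : ℕ, k ≤ N ∧ b y 1 = ub + k * δ)
    (hc : ∀ z, ∃ k : ℕ, k ≤ N ∧ c z 1 = uc + k * δ) :
    totalVert a b c ≤ 2 * Fintype.card G * (3 * N + 1) :=
  (totalVert_le_two_mul_card_mul_card_heightSumset a b c).trans
    (Nat.mul_le_mul_left _ (card_heightSumset_le_of_apHeights a b c ua ub uc δ N ha hb hc))

/-- **The law on the stratum of height-resolution `≤ K|G|`: `T ≤ (6K + 2)|G|²`.** [folklore] -/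
theorem totalVert_le_sq_of_apHeights (a b c : G → (Fin 2 → ℝ)) (ua ub uc δ : ℝ) (N K : ℕ) (hN : N ≤ K * Fintype.card G)
    (ha : ∀ x, ∃ k : ℕ, k ≤ N ∧ a x 1 = ua + k * δ) (hb : ∀ y, ∃ k : ℕ, k ≤ N ∧ b y 1 = ub + k * δ)
    (hc : ∀ z, ∃ k : ℕ, k ≤ N ∧ c z 1 = uc + k * δ) :
    totalVert a b c ≤ (6 * K + 2) * Fintype.card G ^ 2 := by
  have hq : Fintype.card G ≤ Fintype.card G ^ 2 := card_le_card_sq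
  calc totalVert a b c ≤ 2 * Fintype.card G * (3 * N + 1) := totalVert_le_of_apHeights a b c ua ub uc δ N ha hb hc
    _ ≤ 2 * Fintype.card G * (3 * (K * Fintype.card G) + 1) := by gcongr
    _ = 6 * K * Fintype.card G ^ 2 + 2 * Fintype.card G := by ring
    _ ≤ 6 * K * Fintype.card G ^ 2 + 2 * Fintype.card G ^ 2 := by gcongr
    _ = (6 * K + 2) * Fintype.card G ^ 2 := by ring

/-- **Integer heights of range `N`**: if all three curves have natural-number heights `≤ N` then `T ≤ 2|G|(3N + 1)`. [folklore] -/
theorem totalVert_le_of_natHeights (a b c : G → (Fin 2 → ℝ)) (N : ℕ)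
    (ha : ∀ x, ∃ k : ℕ, k ≤ N ∧ a x 1 = k) (hb : ∀ y, ∃ k : ℕ, k ≤ N ∧ b y 1 = k) (hc : ∀ z, ∃ k : ℕ, k ≤ N ∧ c z 1 = k) :
    totalVert a b c ≤ 2 * Fintype.card G * (3 * N + 1) := by
  refine totalVert_le_of_apHeights a b c 0 0 0 1 N ?_ ?_ ?_
  · intro x; obtain ⟨k, hk, h⟩ := ha x; exact ⟨k, hk, by rw [h]; ring⟩
  · intro y; obtain ⟨k, hk, h⟩ := hb y; exact ⟨k, hk, by rw [h]; ring⟩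
  · intro z; obtain ⟨k, hk, h⟩ := hc z; exact ⟨k, hk, by rw [h]; ring⟩

end TotalsLaw

end Summit.ValiantsHypothesis.ValiantsHypothesis.Theorems.NewtonUnitEquationsDissociatedUniform
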